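import Mathlib.Analysis.Analytic.IsolatedZeros
import Mathlib.Analysis.Complex.CauchyIntegral
import Mathlib.Analysis.SpecialFunctions.Complex.Analytic
import Mathlib.Analysis.Calculus.Deriv.Polynomial
import Mathlib.RingTheory.Algebraic.Integral
import Mathlib.RingTheory.Ideal.Quotient.Operations
import Mathlib.Algebra.Polynomial.Roots
import HarnessLib

/-!
# The equimodular class, I: the domain of analytic germs at a point, and evaluation of
# two-variable polynomials in it

HONEST FRAMING.  Cell `pub-schanuel` (Zilber's Exponential-Algebraic Closedness, case ladder;
host summit Schanuel), seat 2, gen 22.  Infrastructure for a TRANSCENDENCE mechanism (no growth):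
the `ℂ`-algebra `AGerm z₀` of germs at `z₀` of functions analytic at `z₀`, realised as the quotient
of the subalgebra of `ℂ → ℂ` of functions analytic at `z₀` by the (prime, by the identity
principle) ideal of functions vanishing near `z₀`; it is an integral domain.  The germ `zGerm z₀` of
the coordinate is transcendental over `ℂ`; evaluation of `P ∈ ℂ[s][t]` at `(z, f(z))` corresponds
to the ring homomorphism `s ↦ zGerm, t ↦ germ f`, and `P(z, f z) = 0` near `z₀` iff that image
vanishes (`evalPP_germ_eq_zero_iff`).  Used in files II–V of this series to decide members of the
equimodular class by transcendence of `log` of a rational function.  Standard material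
([folklore]); nothing here is specific to Schanuel's conjecture (neither used nor implied).
-/

noncomputable section

open Filter Topology Polynomial

set_option linter.dupNamespace false

namespace Summit.Schanuel.Schanuel.Theorems

/-! ## Part A. The subalgebra of functions analytic at `z₀` and its null ideal -/

/-- Functions `ℂ → ℂ` analytic at `z₀`, a `ℂ`-subalgebra of all functions. [folklore] -/
def analyticAtSubalgebra (z₀ : ℂ) : Subalgebra ℂ (ℂ → ℂ) where
  carrier := {f | AnalyticAt ℂ f z₀}
  mul_mem' hf hg := hf.mul hg
  one_mem' := analyticAt_const
  add_mem' hf hg := hf.add hg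
  zero_mem' := analyticAt_const
  algebraMap_mem' c := (analyticAt_const : AnalyticAt ℂ (fun _ : ℂ => c) z₀)

/-- Membership in `analyticAtSubalgebra`. [folklore] -/
theorem mem_analyticAtSubalgebra {z₀ : ℂ} {f : ℂ → ℂ} :
    f ∈ analyticAtSubalgebra z₀ ↔ AnalyticAt ℂ f z₀ := Iff.rfl

/-- The functions analytic at `z₀` that vanish identically near `z₀`: an ideal. [folklore] -/
def nullIdeal (z₀ : ℂ) : Ideal (analyticAtSubalgebra z₀) where
  carrier := {f | (f : ℂ → ℂ) =ᶠ[𝓝 z₀] 0}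
  add_mem' {f g} hf hg := by
    change ((f : ℂ → ℂ) + (g : ℂ → ℂ)) =ᶠ[𝓝 z₀] 0
    have h := hf.add hg
    simpa using h
  zero_mem' := by
    change ((0 : analyticAtSubalgebra z₀) : ℂ → ℂ) =ᶠ[𝓝 z₀] 0
    exact EventuallyEq.rfl
  smul_mem' c {f} hf := by
    change ((c : ℂ → ℂ) * (f : ℂ → ℂ)) =ᶠ[𝓝 z₀] 0
    have h := (EventuallyEq.refl (𝓝 z₀) (c : ℂ → ℂ)).mul hf
    simpa using h

/-- Membership in `nullIdeal`. [folklore] -/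
theorem mem_nullIdeal {z₀ : ℂ} {f : analyticAtSubalgebra z₀} :
    f ∈ nullIdeal z₀ ↔ (f : ℂ → ℂ) =ᶠ[𝓝 z₀] 0 := Iff.rfl

/-- **The null ideal is prime** (identity principle: a product of two functions analytic at `z₀`
vanishes near `z₀` only if a factor does). [folklore] -/
instance nullIdeal_isPrime (z₀ : ℂ) : (nullIdeal z₀).IsPrime := by
  refine ⟨?_, ?_⟩
  · rw [Ideal.ne_top_iff_one]
    intro h
    have h1 : ((1 : analyticAtSubalgebra z₀) : ℂ → ℂ) z₀ = (0 : ℂ → ℂ) z₀ := (mem_nullIdeal.1 h).eq_of_nhds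
    simp at h1
  · intro f g hfg
    have hfg' : ((f : ℂ → ℂ) * (g : ℂ → ℂ)) =ᶠ[𝓝 z₀] 0 := mem_nullIdeal.1 hfg
    rcases (f.2 : AnalyticAt ℂ (f : ℂ → ℂ) z₀).eventually_eq_zero_or_eventually_ne_zero with hf | hf
    · exact Or.inl hf
    rcases (g.2 : AnalyticAt ℂ (g : ℂ → ℂ) z₀).eventually_eq_zero_or_eventually_ne_zero with hg | hg
    · exact Or.inr hg
    exfalso
    have h3 : ∀ᶠ z in 𝓝[≠] z₀, ((f : ℂ → ℂ) * (g : ℂ → ℂ)) z = 0 := hfg'.filter_mono nhdsWithin_le_nhds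
    haveI := NormedField.nhdsNE_neBot z₀
    obtain ⟨z, hz1, hz2, hz3⟩ := (hf.and (hg.and h3)).exists
    exact mul_ne_zero hz1 hz2 hz3

/-! ## Part B. The domain of analytic germs -/

/-- **The `ℂ`-algebra of germs at `z₀` of functions analytic at `z₀`** — an integral domain.
(A `def`, not an `abbrev`: instance search on the unfolded quotient is slow.) [folklore] -/
def AGerm (z₀ : ℂ) : Type := analyticAtSubalgebra z₀ ⧸ nullIdeal z₀

namespace AGerm

variable {z₀ : ℂ}

/-- The ring structure of `AGerm z₀` (quotient ring). [folklore] -/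
instance instCommRing (z₀ : ℂ) : CommRing (AGerm z₀) :=
  inferInstanceAs (CommRing (analyticAtSubalgebra z₀ ⧸ nullIdeal z₀))

/-- The `ℂ`-algebra structure of `AGerm z₀`. [folklore] -/
instance instAlgebra (z₀ : ℂ) : Algebra ℂ (AGerm z₀) :=
  inferInstanceAs (Algebra ℂ (analyticAtSubalgebra z₀ ⧸ nullIdeal z₀))

/-- `AGerm z₀` is an integral domain (the null ideal is prime). [folklore] -/
instance instIsDomain (z₀ : ℂ) : IsDomain (AGerm z₀) :=
  inferInstanceAs (IsDomain (analyticAtSubalgebra z₀ ⧸ nullIdeal z₀))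

/-- The germ of a function analytic at `z₀`. [folklore] -/
def mk (z₀ : ℂ) {f : ℂ → ℂ} (hf : AnalyticAt ℂ f z₀) : AGerm z₀ :=
  (Ideal.Quotient.mk (nullIdeal z₀) ⟨f, mem_analyticAtSubalgebra.2 hf⟩ :
    analyticAtSubalgebra z₀ ⧸ nullIdeal z₀)

/-- Two germs agree iff the functions agree near `z₀`. [folklore] -/
theorem mk_eq_mk_iff {f g : ℂ → ℂ} (hf : AnalyticAt ℂ f z₀) (hg : AnalyticAt ℂ g z₀) :
    mk z₀ hf = mk z₀ hg ↔ f =ᶠ[𝓝 z₀] g := by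
  change (Ideal.Quotient.mk (nullIdeal z₀) ⟨f, mem_analyticAtSubalgebra.2 hf⟩ :
      analyticAtSubalgebra z₀ ⧸ nullIdeal z₀) =
    Ideal.Quotient.mk (nullIdeal z₀) ⟨g, mem_analyticAtSubalgebra.2 hg⟩ ↔ _
  rw [Ideal.Quotient.eq, mem_nullIdeal]
  change (f - g) =ᶠ[𝓝 z₀] 0 ↔ _
  constructor
  · intro h
    filter_upwards [h] with z hz
    exact sub_eq_zero.1 hz
  · intro h
    filter_upwards [h] with z hz
    simp [hz]

/-- A germ vanishes iff the function vanishes near `z₀`. [folklore] -/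
theorem mk_eq_zero_iff {f : ℂ → ℂ} (hf : AnalyticAt ℂ f z₀) :
    mk z₀ hf = 0 ↔ f =ᶠ[𝓝 z₀] 0 := by
  change (Ideal.Quotient.mk (nullIdeal z₀) ⟨f, mem_analyticAtSubalgebra.2 hf⟩ :
      analyticAtSubalgebra z₀ ⧸ nullIdeal z₀) = 0 ↔ _
  rw [Ideal.Quotient.eq_zero_iff_mem, mem_nullIdeal]

/-- Germs of pointwise-equal functions agree (whatever the analyticity witnesses). [folklore] -/
theorem mk_congr {f g : ℂ → ℂ} (hf : AnalyticAt ℂ f z₀) (hg : AnalyticAt ℂ g z₀) (h : ∀ z, f z = g z) :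
    mk z₀ hf = mk z₀ hg :=
  (mk_eq_mk_iff hf hg).2 (Eventually.of_forall h)

/-- Germs: addition. [folklore] -/
theorem mk_add {f g : ℂ → ℂ} (hf : AnalyticAt ℂ f z₀) (hg : AnalyticAt ℂ g z₀) :
    mk z₀ (hf.add hg) = mk z₀ hf + mk z₀ hg := rfl

/-- Germs: multiplication. [folklore] -/
theorem mk_mul {f g : ℂ → ℂ} (hf : AnalyticAt ℂ f z₀) (hg : AnalyticAt ℂ g z₀) :
    mk z₀ (hf.mul hg) = mk z₀ hf * mk z₀ hg := rfl

/-- Germs: subtraction. [folklore] -/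
theorem mk_sub {f g : ℂ → ℂ} (hf : AnalyticAt ℂ f z₀) (hg : AnalyticAt ℂ g z₀) :
    mk z₀ (hf.sub hg) = mk z₀ hf - mk z₀ hg := rfl

/-- Germs: negation. [folklore] -/
theorem mk_neg {f : ℂ → ℂ} (hf : AnalyticAt ℂ f z₀) : mk z₀ hf.neg = -mk z₀ hf := rfl

/-- Germs: powers. [folklore] -/
theorem mk_pow {f : ℂ → ℂ} (hf : AnalyticAt ℂ f z₀) (n : ℕ) :
    mk z₀ (hf.pow n) = mk z₀ hf ^ n := rfl

/-- The germ of a constant is the scalar. [folklore] -/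
theorem mk_const (c : ℂ) :
    mk z₀ (analyticAt_const : AnalyticAt ℂ (fun _ : ℂ => c) z₀) = algebraMap ℂ (AGerm z₀) c := rfl

/-- The germ of the constant `1`. [folklore] -/
theorem mk_one : mk z₀ (analyticAt_const : AnalyticAt ℂ (fun _ : ℂ => (1 : ℂ)) z₀) = 1 := rfl

/-- A germ whose function does not vanish AT `z₀` is nonzero. [folklore] -/
theorem mk_ne_zero_of_apply_ne_zero {f : ℂ → ℂ} (hf : AnalyticAt ℂ f z₀) (h : f z₀ ≠ 0) :
    mk z₀ hf ≠ 0 := by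
  intro h0
  exact h ((mk_eq_zero_iff hf).1 h0).eq_of_nhds

/-- The germ of a function without zeros (e.g. an exponential) is nonzero. [folklore] -/
theorem mk_ne_zero_of_forall_ne_zero {f : ℂ → ℂ} (hf : AnalyticAt ℂ f z₀) (h : ∀ z, f z ≠ 0) :
    mk z₀ hf ≠ 0 :=
  mk_ne_zero_of_apply_ne_zero hf (h z₀)

end AGerm

/-! ## Part C. The coordinate germ is transcendental; polynomial evaluation -/

/-- The germ of the coordinate function `z ↦ z`. [folklore] -/
def zGerm (z₀ : ℂ) : AGerm z₀ := AGerm.mk z₀ analyticAt_id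

/-- A polynomial function is analytic. [folklore] -/
theorem analyticAt_polynomial_eval (r : ℂ[X]) (z₀ : ℂ) : AnalyticAt ℂ (fun z => r.eval z) z₀ :=
  (Polynomial.differentiable r).analyticAt z₀

/-- **`aeval` at the coordinate germ is the germ of the polynomial function.** [folklore] -/
theorem aeval_zGerm (z₀ : ℂ) (r : ℂ[X]) :
    Polynomial.aeval (zGerm z₀) r = AGerm.mk z₀ (analyticAt_polynomial_eval r z₀) := by
  induction r using Polynomial.induction_on' with
  | add p q hp hq =>
    rw [map_add, hp, hq, ← AGerm.mk_add]
    exact AGerm.mk_congr _ _ fun z => by simp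
  | monomial n a =>
    rw [Polynomial.aeval_monomial, ← AGerm.mk_const, zGerm, ← AGerm.mk_pow, ← AGerm.mk_mul]
    exact AGerm.mk_congr _ _ fun z => by simp [Polynomial.eval_monomial]

/-- **The coordinate germ is transcendental over `ℂ`** (a nonzero polynomial does not vanish on a
neighbourhood). [folklore] -/
theorem transcendental_zGerm (z₀ : ℂ) : Transcendental ℂ (zGerm z₀) := by
  rintro ⟨r, hr0, hr⟩
  rw [aeval_zGerm, AGerm.mk_eq_zero_iff] at hr
  apply hr0
  have hzero : Set.EqOn (fun z => r.eval z) 0 Set.univ :=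
    AnalyticOnNhd.eqOn_zero_of_preconnected_of_eventuallyEq_zero
      (fun z _ => analyticAt_polynomial_eval r z) isPreconnected_univ (Set.mem_univ z₀) hr
  exact Polynomial.funext fun z => by simpa using hzero (Set.mem_univ z)

/-- `aeval zGerm r ≠ 0` for `r ≠ 0`. [folklore] -/
theorem aeval_zGerm_ne_zero (z₀ : ℂ) {r : ℂ[X]} (hr : r ≠ 0) : Polynomial.aeval (zGerm z₀) r ≠ 0 :=
  fun h => (transcendental_zGerm z₀) ⟨r, hr, h⟩


/-! ## Part D. Two-variable polynomials `P ∈ ℂ[s][t]` evaluated at `(z, f z)` -/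

/-- `z ↦ P(z, f z)` is analytic at `z₀` when `f` is. [folklore] -/
theorem analyticAt_evalPP {z₀ : ℂ} {f : ℂ → ℂ} (hf : AnalyticAt ℂ f z₀) (P : ℂ[X][X]) :
    AnalyticAt ℂ (fun z => (P.map (Polynomial.evalRingHom z)).eval (f z)) z₀ := by
  have e : (fun z => (P.map (Polynomial.evalRingHom z)).eval (f z)) =
      fun z => ∑ i ∈ Finset.range (P.natDegree + 1), (P.coeff i).eval z * f z ^ i := by
    funext z
    rw [Polynomial.eval_map, Polynomial.eval₂_eq_sum_range]
    rfl
  rw [e]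
  exact Finset.analyticAt_fun_sum _ fun i _ => (analyticAt_polynomial_eval _ _).mul (hf.pow i)

/-- The evaluation homomorphism `ℂ[s][t] → AGerm z₀`, `s ↦ zGerm`, `t ↦ v`. [folklore] -/
def germEval₂ (z₀ : ℂ) (v : AGerm z₀) : ℂ[X][X] →+* AGerm z₀ :=
  Polynomial.eval₂RingHom (Polynomial.eval₂RingHom (algebraMap ℂ (AGerm z₀)) (zGerm z₀)) v

/-- Germ evaluation on constants (in `t`): `aeval zGerm`. [folklore] -/
theorem germEval₂_C (z₀ : ℂ) (v : AGerm z₀) (r : ℂ[X]) :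
    germEval₂ z₀ v (Polynomial.C r) = Polynomial.aeval (zGerm z₀) r := by
  rw [germEval₂, Polynomial.coe_eval₂RingHom, Polynomial.eval₂_C, Polynomial.coe_eval₂RingHom,
    ← Polynomial.aeval_def]

/-- Germ evaluation on `t`. [folklore] -/
theorem germEval₂_X (z₀ : ℂ) (v : AGerm z₀) : germEval₂ z₀ v Polynomial.X = v := by
  rw [germEval₂, Polynomial.coe_eval₂RingHom, Polynomial.eval₂_X]

/-- **Germ evaluation is the germ of the evaluated function**:
`(s ↦ zGerm, t ↦ germ f)(P) = germ (z ↦ P(z, f z))`. [folklore] -/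
theorem germEval₂_mk {z₀ : ℂ} {f : ℂ → ℂ} (hf : AnalyticAt ℂ f z₀) (P : ℂ[X][X]) :
    germEval₂ z₀ (AGerm.mk z₀ hf) P = AGerm.mk z₀ (analyticAt_evalPP hf P) := by
  induction P using Polynomial.induction_on' with
  | add p q hp hq =>
    rw [map_add, hp, hq, ← AGerm.mk_add]
    exact AGerm.mk_congr _ _ fun z => by
      simp only [Pi.add_apply, Polynomial.map_add, Polynomial.eval_add]
  | monomial n r =>
    rw [germEval₂, Polynomial.coe_eval₂RingHom, Polynomial.eval₂_monomial,
      Polynomial.coe_eval₂RingHom, ← Polynomial.aeval_def, aeval_zGerm, ← AGerm.mk_pow,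
      ← AGerm.mk_mul]
    exact AGerm.mk_congr _ _ fun z => by
      simp only [Pi.mul_apply, Pi.pow_apply, Polynomial.map_monomial, Polynomial.eval_monomial,
        Polynomial.coe_evalRingHom]

/-- **`P(z, f z) = 0` near `z₀` iff the germ evaluation vanishes.** [folklore] -/
theorem germEval₂_mk_eq_zero_iff {z₀ : ℂ} {f : ℂ → ℂ} (hf : AnalyticAt ℂ f z₀) (P : ℂ[X][X]) :
    germEval₂ z₀ (AGerm.mk z₀ hf) P = 0 ↔
      (fun z => (P.map (Polynomial.evalRingHom z)).eval (f z)) =ᶠ[𝓝 z₀] 0 := by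
  rw [germEval₂_mk, AGerm.mk_eq_zero_iff]

/-! ## Part E. Minimal relations and algebraicity over `ℂ[zGerm]` -/

/-- From some nonzero `P` in the kernel of a ring homomorphism on `ℂ[s][t]`, one of minimal
`t`-degree. [folklore] -/
theorem exists_minDegree_of_exists {S : Type*} [Semiring S] (Θ : ℂ[X][X] →+* S)
    (h : ∃ P : ℂ[X][X], P ≠ 0 ∧ Θ P = 0) :
    ∃ P : ℂ[X][X], P ≠ 0 ∧ Θ P = 0 ∧ ∀ Q : ℂ[X][X], Q ≠ 0 → Θ Q = 0 → P.natDegree ≤ Q.natDegree := by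
  classical
  have hex : ∃ n, ∃ P : ℂ[X][X], P ≠ 0 ∧ Θ P = 0 ∧ P.natDegree = n := by
    obtain ⟨P, h1, h2⟩ := h
    exact ⟨_, P, h1, h2, rfl⟩
  obtain ⟨P, hP0, hPΘ, hPn⟩ := Nat.find_spec hex
  refine ⟨P, hP0, hPΘ, fun Q hQ0 hQ => ?_⟩
  rw [hPn]
  exact Nat.find_min' hex ⟨Q, hQ0, hQ, rfl⟩

/-- The subalgebra `ℂ[zGerm z₀]` has no zero divisors. [folklore] -/
instance adjoin_zGerm_noZeroDivisors (z₀ : ℂ) :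
    NoZeroDivisors (Algebra.adjoin ℂ ({zGerm z₀} : Set (AGerm z₀))) := inferInstance

/-- Polynomials in `zGerm` are algebraic over `ℂ[zGerm]` (they lie in it). [folklore] -/
theorem isAlgebraic_aeval_zGerm (z₀ : ℂ) (r : ℂ[X]) :
    IsAlgebraic (Algebra.adjoin ℂ ({zGerm z₀} : Set (AGerm z₀))) (Polynomial.aeval (zGerm z₀) r) := by
  have hmem : Polynomial.aeval (zGerm z₀) r ∈ Algebra.adjoin ℂ ({zGerm z₀} : Set (AGerm z₀)) :=
    Polynomial.aeval_mem_adjoin_singleton ℂ _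
  exact isAlgebraic_algebraMap
    (⟨_, hmem⟩ : Algebra.adjoin ℂ ({zGerm z₀} : Set (AGerm z₀)))

/-- **Images of the germ evaluation at an algebraic `v` are algebraic over `ℂ[zGerm]`.**
[folklore] -/
theorem isAlgebraic_germEval₂ {z₀ : ℂ} {v : AGerm z₀}
    (hv : IsAlgebraic (Algebra.adjoin ℂ ({zGerm z₀} : Set (AGerm z₀))) v) (Q : ℂ[X][X]) :
    IsAlgebraic (Algebra.adjoin ℂ ({zGerm z₀} : Set (AGerm z₀))) (germEval₂ z₀ v Q) := by
  rw [germEval₂, Polynomial.coe_eval₂RingHom, Polynomial.eval₂_eq_sum_range]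
  refine Finset.sum_induction _ (fun x => IsAlgebraic (Algebra.adjoin ℂ ({zGerm z₀} : Set (AGerm z₀))) x)
    (fun a b ha hb => ha.add hb) isAlgebraic_zero fun i _ => ?_
  rw [Polynomial.coe_eval₂RingHom, ← Polynomial.aeval_def]
  exact (isAlgebraic_aeval_zGerm z₀ _).mul (hv.pow i)

/-- **A nonzero relation `H(zGerm, v) = 0` makes `v` algebraic over `ℂ[zGerm]`.** [folklore] -/
theorem isAlgebraic_of_germEval₂_eq_zero {z₀ : ℂ} (v : AGerm z₀) {H : ℂ[X][X]} (hH0 : H ≠ 0)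
    (hH : germEval₂ z₀ v H = 0) :
    IsAlgebraic (Algebra.adjoin ℂ ({zGerm z₀} : Set (AGerm z₀))) v := by
  set B := Algebra.adjoin ℂ ({zGerm z₀} : Set (AGerm z₀)) with hB
  set φ : ℂ[X] →ₐ[ℂ] B := Polynomial.aeval (⟨zGerm z₀, Algebra.self_mem_adjoin_singleton ℂ _⟩ : B)
    with hφ
  have hφval : ∀ a, ((φ a : B) : AGerm z₀) = Polynomial.aeval (zGerm z₀) a := fun a => by
    change B.val (φ a) = _
    rw [hφ, ← Polynomial.aeval_algHom_apply B.val]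
    rfl
  have hφinj : Function.Injective φ := by
    intro a b hab
    have h := congrArg (fun x : B => (x : AGerm z₀)) hab
    simp only [hφval] at h
    exact (transcendental_iff_injective.1 (transcendental_zGerm z₀)) h
  refine ⟨H.map φ.toRingHom, ?_, ?_⟩
  · intro h0
    rw [Polynomial.map_eq_zero_iff hφinj] at h0
    exact hH0 h0
  · rw [Polynomial.aeval_def, Polynomial.eval₂_map]
    have hcomp : (algebraMap B (AGerm z₀)).comp φ.toRingHom =
        Polynomial.eval₂RingHom (algebraMap ℂ (AGerm z₀)) (zGerm z₀) := by
      refine Polynomial.ringHom_ext (fun a => ?_) ?_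
      · rw [RingHom.comp_apply, Polynomial.coe_eval₂RingHom, Polynomial.eval₂_C]
        change ((φ (Polynomial.C a) : B) : AGerm z₀) = _
        rw [hφval, Polynomial.aeval_C]
      · rw [RingHom.comp_apply, Polynomial.coe_eval₂RingHom, Polynomial.eval₂_X]
        change ((φ Polynomial.X : B) : AGerm z₀) = _
        rw [hφval, Polynomial.aeval_X]
    rw [hcomp]
    exact hH

/-! ## Part F. Polynomial operators on `ℂ[s][t]` used in files II–III (definitions only) -/

/-- **The differentiated relation.**  For `P = Σ p_j t^j` of `t`-degree `≤ N`:
`derivRel A B P = Σ_{j ≤ N} (A B p_j' + (j + 1)(A B' - A' B) p_{j+1}) t^j`. [folklore] -/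
def derivRel (A B : ℂ[X]) (P : ℂ[X][X]) : ℂ[X][X] :=
  ∑ j ∈ Finset.range (P.natDegree + 1),
    Polynomial.monomial j (A * B * derivative (P.coeff j) +
      ((j + 1 : ℕ) : ℂ[X]) * (A * derivative B - derivative A * B) * P.coeff (j + 1))

/-- `coeffDeriv H = Σ_j h_j' t^j`. [folklore] -/
def coeffDeriv (H : ℂ[X][X]) : ℂ[X][X] :=
  ∑ j ∈ Finset.range (H.natDegree + 1), Polynomial.monomial j (derivative (H.coeff j))

/-- `weightDeg H = Σ_j j h_j t^j` (`= t ∂_t H`). [folklore] -/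
def weightDeg (H : ℂ[X][X]) : ℂ[X][X] :=
  ∑ j ∈ Finset.range (H.natDegree + 1), Polynomial.monomial j ((j : ℂ[X]) * H.coeff j)

end Summit.Schanuel.Schanuel.Theorems
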